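import Summits.BirchSwinnertonDyer.Rank1Residual.AdditivePotMult.PotMultBranchPAdicValIdentityRouteG
import Summits.BirchSwinnertonDyer.Rank1Residual.AdditivePotMult.PotMultX3BranchPAdicGrossZagierIffRouteG
import Summits.BirchSwinnertonDyer.Rank1Residual.Additive.CensusQ6CoeffValuation
import HarnessLib

/-!
# X3♯(M) (REDUCIBLE `E[p]`, potentially multiplicative) ∧ `r_an = 1`, EVERY odd `p` (`p = 3` included):
# on the INDEX-`n₀` rows of Route G the `p`-part of BSD is ONE valuation statement —
# `BSD(E,p) ⟺ ord_p q + ord_p Reg_p(E,Dh) = 1 + v₁`, `v₁ = ord_p [T¹](ϖ·L_p^±(f_{E♭}, ±1, ω^{(p−1)/2}, T))`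
# — and the EXACT `ℓ`-free identity `ord_p #Ш(E) + ord_p Reg_p(E,Dh) + ord_p ∏c_ℓ = v₁ + 1 + 2·ord_p #E(ℚ)_tors`
# per admissible datum; PLUS the census-literal forms fed by census-ctyper1's valuation record
# `CensusQ6.MultCoeffValAt W p 1 v₁` (`v₁ ∈ ℤ` a column of the Q6 table) — the X3♯(M) twin of
# n1011-p07 (gen 3)'s T-E3gM FILE 2d `PotMultBranchPAdicValIdentityRouteG.lean` (cell `b2b-bsdres`, team
# n1011, seat p12 (gen 3); p07-g3's close 2026-08-21T09:07Z: "X3♯(M) twins = p12's queue"; the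
# `MultCoeffValAt` interlock = p07-g3's open item (i), census-ctyper1's word given in
# `Additive/CensusQ6CoeffValuation.lean` §1)

HONEST FRAMING (cell `b2b-bsdres`, run/shared/lean/b2b/bsd-rank1-residual/, verbatim in every
file): the goal of the cell is to DELETE the COMBINATION-SHAPED residual classes of the
Birch–Swinnerton-Dyer formula for ALL analytic-rank `≤ 1` elliptic curves over `ℚ` — "full BSD
formula for every rank `≤ 1` curve in class `C`" assembled STRICTLY from published theorems — so
that the rank-`≤ 1` remainder becomes exactly the CONSTRUCTION-SHAPED classes, which are TYPED
(missing-input `Prop`s), NOT attempted. This is not "finishing BSD". Team n1011 (RESIDUAL-MAP §I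
O7-ord, X3♯(M) share: X3 ∧ pot-mult(p) ∧ `r_an = 1`, every odd `p`): research route on the
CONSTRUCTION-SHAPED class O7; O7-ord stays OPEN and CONSTRUCTION-SHAPED; labels and marks UNCHANGED;
nothing booked — the OUTPUT is an EQUIVALENCE of `BSD(E,p)` with ONE `p`-adic valuation per (B)-datum
(`Reg_p(E,Dh)` has NO engine in the cell), NOT `BSD(E,p)`; every statement is PER PAIR modulo the named
facts AND per-pair inputs outside the kernel: the census record at index `n₀` (CERTIFICATE-EVIDENCE,
two engines), the budget (n1011-p10's typed `BudgetLeLambdaAt`; a theorem when `n₀ ≤ rank`; on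
REDUCIBLE rows an UNPRINTED per-pair binder for `n₀ > rank`, see BUDGET SOURCE below), the ONE-SIDED bit
`c₁ ≠ 0` and its valuation `v₁` for the datum at hand (or census-ctyper1's valuation record
`MultCoeffValAt W p 1 v₁`, CERTIFICATE-EVIDENCE). NO Literature fact minted; NO definition. THEOREMS
ONLY; named facts enter as HYPOTHESES only: `hW16` (Wuthrich 2014 Thm. 16, half-eigen divisibility with
REDUCIBLE `E[p]`, `Wuthrich2014.thm16_halfEigenCharIdeal_dvd_cyclotomicPrime`), `hGZK`, `hmod`, `hmodD`.
Debt 0.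

## What and why (ROUTE-2 §II.12.1 (iv)–(v), r2 GEN 6; p07's FILE 2d proofs verbatim with
## (hK ∧ Surj ∧ tower) ↦ hW16 ∧ reducibility)

On an `r_an = 1` X3♯(M) row, Route G's X3 K-OUT (`charIdeal_eq_span_of_wuthrichHalf_of_norm_coeff_of_budget`,
`PotMultWuthrichFirstUnitIndex.lean` §1: `char_Λ X(E/ℚ_∞) = (g)`, `ι g = C(u·ϖ)·B` from Wuthrich's
divisibility (NO tower, `E♭[p]` reducible by `irr_iff_of_model_twist`) + the record's unit at index `n₀` +
`BudgetLeLambdaAt p W n₀`) feeds n1011-p01's cell-agnostic T-E3g (ii) rider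
`schneider_and_padicVal_identity_rankOne_of_charIdeal_eq_span_of_iota_eq` (`char = (g)` +
`[T¹](ϖ·B) ≠ 0` + `rank = 1` ⟹ Schneider ∧ `Ш[p^∞]` finite ∧ the EXACT identity with `v₁`); on (M)
`ℓ_p = 1` (`PotMult.reductionNonAnomalous`) and `Ш(E)` is finite by GZK:

* §1 `ClassX3M.schneider_and_padicVal_identity_rankOne_of_wuthrichHalf_of_firstUnitIndex_of_budget`: for
  every multiplicative twist datum `(V, C, f, a_p, ϖ)` with `[T¹](ϖ·B) ≠ 0` and every (B)-datum `Dh`: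
  Schneider and **`ord_p #Ш(E) + ord_p Reg_p(E,Dh) + ord_p ∏c_ℓ = v₁ + 1 + 2·ord_p #E(ℚ)_tors`**
  (`v₁ = 0` recovers T-O7KM-X3's `…identity_rankOne_of_wuthrichHalf_of_multCert`).
* §2 HEADLINE `ClassX3M.bsdp_iff_padicVal_rankOne_of_wuthrichHalf_of_firstUnitIndex_of_budget`: with
  `L'(E,1) = q·Ω_E·Reg_∞(E)`, **`BSD(E,p) ⟺ ord_p q + ord_p Reg_p(E,Dh) = 1 + v₁`**.
* §3 CENSUS-LITERAL forms over census-ctyper1's valuation record `CensusQ6.MultCoeffValAt W p 1 v₁`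
  (`‖[T¹](ϖ·B)‖_p = p^{−v₁}` on EVERY multiplicative twist datum; `v₁ ∈ ℤ`): the datum DISAPPEARS from
  the statement — `ClassX3M.schneider_and_padicVal_identity_rankOne_of_wuthrichHalf_of_firstUnitIndex_of_multCoeffValAt_of_budget`
  (**`ord_p #Ш(E) + ord_p Reg_p(E,Dh) + ord_p ∏c_ℓ = v₁ + 1 + 2·ord_p #E(ℚ)_tors`**), the HEADLINE
  `ClassX3M.bsdp_iff_padicVal_rankOne_of_wuthrichHalf_of_firstUnitIndex_of_multCoeffValAt_of_budget`
  (**`BSD(E,p) ⟺ ord_p q + ord_p Reg_p(E,Dh) = 1 + v₁`**), and the `p = 3` forms `…three…` (record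
  `MultOddFirstUnitIndexAt W 3 n₀`, column `MultCoeffValAt W 3 1 v₁`, budget `BudgetLeLambdaAt 3 W n₀`).

What is NOT claimed: `BSD(E,p)` on any row; `v(Reg_p)` (no engine); the record / budget / bit / column
inputs (instrument tier, per pair); `p = 2`. NOT binders: `Surj`, tower, `5 ≤ p`, `¬CM`, `hna`, `hL20`,
`hPal`. Nothing booked; no number closes anything; X3 / O7-ord stay CONSTRUCTION-SHAPED.

BUDGET SOURCE ON X3 ROWS (n1011-r2 GEN 7, ROUTE-2 II.13.2): n1011-p10's typed input `BudgetLeLambdaAt p W b`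
is a THEOREM for `b ≤ rank E(ℚ)` (p07's `budgetLeLambdaAt_of_le_mordellWeilRank`); for `b > rank E(ℚ)`
its printed discharge (Emerton–Pollack–Weston 2006) assumes `ρ̄` ABSOLUTELY IRREDUCIBLE, so on X3 rows
the budget is an UNPRINTED per-pair binder (candidate discharge: Greenberg LNM 1716 Prop. 4.14 +
Greenberg 2010 Prop. 3.2.1 (b) + II.10.9 — T-E3gX3-bud, cc-typer-2's schema).

References: C. Wuthrich, Doc. Math. 19 (2014) Thm. 16, §3 [Wuthrich2014]; D. Delbourgo, J. Number
Theory 95 (2002) Thm. (B) [Delbourgo2002]; M. Emerton, R. Pollack, T. Weston, Invent. Math. 163 (2006)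
§3 (source of the typed budget on irreducible rows only; X3: see above) [EmertonPollackWeston2006];
B. Mazur, J. Tate, J. Teitelbaum, Invent. Math. 84 (1986) §I.10, §I.13 [MazurTateTeitelbaum1986Invent];
R. L. Miller, LMS J. Comput. Math. 14 (2011) Def. 1.1 [Miller2011LMS]; L. Washington, GTM 83 (1997)
§7.1 [Washington1997].
-/

set_option autoImplicit false

noncomputable section

open scoped Classical MatrixGroups ModularForm NumberField

namespace Summit.BirchSwinnertonDyer.Rank1Residual.AdditivePotMult

open CongruenceSubgroup WeierstrassCurve NumberField Literature.NumberTheory.EllipticCurves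
  Literature.NumberTheory.EllipticCurves.ModularForms
  Literature.NumberTheory.EllipticCurves.Rank1Residual
  Literature.NumberTheory.EllipticCurves.Rank1Residual.Typed
  Literature.NumberTheory.EllipticCurves.Delbourgo2002
  Literature.NumberTheory.GaloisRepresentations
  Summit.BirchSwinnertonDyer.Rank1Residual.Additive
  Summit.BirchSwinnertonDyer.Rank1Residual.Additive.CensusQ6
  IsDedekindDomain

/-! ### §1 The EXACT `v₁`-identity per admissible datum on the index-`n₀` X3♯(M) rows -/

section Identity

variable {W : WeierstrassCurve ℚ} [W.IsElliptic] [W.IsGloballyMinimal] {p : ℕ} [hp : Fact p.Prime]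

/-- **T-E3gM (ii) on the X3♯(M) rows: the EXACT `v₁`-identity per admissible datum.** X3♯(M) ∧
`r_an = 1`, EVERY odd `p` (`p = 3` included), `E[p]` REDUCIBLE; Wuthrich's half `hW16` + the census
record at index `n₀` + the budget `BudgetLeLambdaAt p W n₀` (X3 K-OUT: `char_Λ X(E/ℚ_∞) = (g)`,
`ι g = C(u·ϖ)·B`, `charIdeal_eq_span_of_wuthrichHalf_of_norm_coeff_of_budget`; NO tower) +
`[T¹](ϖ·B) ≠ 0` for THIS multiplicative twist datum `(V, C, f, a_p, ϖ)` (`hne`, one-sided bit) ⟹ for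
every (B)-datum `Dh`: Schneider and
`ord_p #Ш(E) + ord_p Reg_p(E,Dh) + ord_p ∏c_ℓ = v_p([T¹](ϖ·B)) + 1 + 2·ord_p #E(ℚ)_tors` — n1011-p01's
T-E3g (ii) rider BY NAME, with `ℓ_p = 1` on (M) (`PotMult.reductionNonAnomalous`) and `Ш(E)` finite
(GZK). `v₁ = 0` (index-`1` UNIT rows) is T-O7KM-X3's `…identity_rankOne_of_wuthrichHalf_of_multCert`.
[cite: Wuthrich2014, Thm. 16 (p. 397)] [cite: Delbourgo2002, Theorem (B) (p. 40), ℓ_p(E) = 1 (p. 39)]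
[cite: EmertonPollackWeston2006, Cor. 3.2.5 and Thm. 3.1.1 (typed input's source on IRREDUCIBLE rows only; X3: see header)]
[cite: Washington1997, §7.1] -/
theorem ClassX3M.schneider_and_padicVal_identity_rankOne_of_wuthrichHalf_of_firstUnitIndex_of_budget
    (hW16 : Wuthrich2014.thm16_halfEigenCharIdeal_dvd_cyclotomicPrime)
    (hGZK : rank_eq_analyticRank_of_analyticRank_le_one)
    (hX : ClassX3M W p) (hr : W.analyticRank = 1) {n₀ : ℕ}
    (hrec : (p % 4 = 1 → MultFirstUnitIndexAt W p n₀) ∧ (p % 4 = 3 → MultOddFirstUnitIndexAt W p n₀))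
    (hbud : BudgetLeLambdaAt p W n₀)
    (V : WeierstrassCurve ℚ) [V.IsElliptic] [V.IsGloballyMinimal] (C : VariableChange ℚ)
    (hV : Mult V p) (hC : C • V.quadraticTwist ((-1 : ℚ) ^ (p / 2) * p) = W)
    {N : ℕ} [NeZero N] {f : CuspForm (Gamma0 N) 2} (hf : IsNewformOf V f) (ap : ℤ)
    (hap : cuspCoeff f p = ap) (ϖ : ℚ)
    (hϖ : if Even (p / 2) then (ϖ : ℝ) * V.realPeriodRat = plusPeriod f
      else (ϖ : ℝ) * V.imaginaryPeriodRat = minusPeriod f)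
    (hne : PowerSeries.coeff 1 (PowerSeries.C (ϖ : ℚ_[p]) *
      (if Even (p / 2) then padicLFunctionPlusBranchMult f (ap : ℚ_[p]) (p / 2)
        else padicLFunctionMinusBranchMult f (ap : ℚ_[p]) (p / 2))) ≠ 0)
    {Dh : PAdicHeightData W p} (hB : LeadingTermClauses W p Dh) :
    SchneiderConjecture Dh ∧
      (padicValNat p W.shaOrder : ℤ) + (padicRegulator Dh).valuation + padicValNat p W.tamagawaProduct =
        (PowerSeries.coeff 1 (PowerSeries.C (ϖ : ℚ_[p]) *
            (if Even (p / 2) then padicLFunctionPlusBranchMult f (ap : ℚ_[p]) (p / 2)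
              else padicLFunctionMinusBranchMult f (ap : ℚ_[p]) (p / 2)))).valuation +
          1 + 2 * padicValNat p W.torsionOrder := by
  have hp2 : p ≠ 2 := hX.p_ne_two
  obtain ⟨hmw, hfinSha⟩ := hGZK W (by rw [hr])
  have hr1 : W.mordellWeilRank = 1 := by rw [hmw, hr]
  haveI : Finite W.sha := hfinSha
  -- `V[p]` is reducible with `W[p]` (NO image hypothesis on the X3 side)
  have hirrV : ¬ V.HasIrreducibleModPGaloisRep p := fun hVirr ↦
    hX.classX3.1 ((irr_iff_of_model_twist (W := V) (p := p) (pStar_ne_zero p) ⟨C, hC⟩).mpr hVirr)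
  obtain ⟨κ, hκ, γ, hγ, hγ'⟩ := exists_isCyclotomic_isTopGenerator_isCyclotomicVariable_holds p
  obtain ⟨D⟩ := W.nonempty_selmerDualData_holds κ γ hγ
  haveI : Module.Finite (IwasawaAlgebra p) D.X := D.module_finite_holds hγ
  -- the record's unit at index `n₀` for this datum
  have hn := norm_coeff_multBranch_eq_one_of_firstUnitIndex hp2 hrec V C hV hC f hf ap hap ϖ hϖ
  -- `a_p(E♭) = ±1`: put the series in the literal shape of the brick's disjunction
  by_cases hs : V.HasSplitMultiplicativeReductionAtPrime p
  · obtain ⟨h1, -⟩ := hf.cuspCoeff_eq_one_and_sq_of_split hs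
    have hap1 : (ap : ℚ_[p]) = 1 := by
      have : ((ap : ℤ) : ℂ) = ((1 : ℤ) : ℂ) := by push_cast; exact_mod_cast hap.symm.trans h1
      have hZ : ap = 1 := by exact_mod_cast this
      rw [hZ, Int.cast_one]
    rw [hap1] at hn hne ⊢
    obtain ⟨hXt, g, hchar, ⟨u, hι⟩, -, -, -⟩ :=
      charIdeal_eq_span_of_wuthrichHalf_of_norm_coeff_of_budget hW16 hp2 hbud V C hC hirrV hκ hγ hγ' hf D _
        (Or.inr (Or.inl ⟨hs, rfl⟩)) ϖ hϖ hn
    obtain ⟨hS, -, ℓ, -, hℓ1, hid⟩ :=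
      schneider_and_padicVal_identity_rankOne_of_charIdeal_eq_span_of_iota_eq hp2 hr1 hB hκ hγ hγ' D hXt
        hchar hι hne
    refine ⟨hS, ?_⟩
    rw [hℓ1 hX.potMult.reductionNonAnomalous, padicValNat_one_right, Nat.cast_zero, add_zero,
      padicValNat_card_addPrimaryComponent] at hid
    exact hid
  · obtain ⟨h1, -⟩ := hf.cuspCoeff_eq_neg_one_and_dvd_of_nonsplit hV hs
    have hap1 : (ap : ℚ_[p]) = -1 := by
      have : ((ap : ℤ) : ℂ) = ((-1 : ℤ) : ℂ) := by push_cast; exact_mod_cast hap.symm.trans h1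
      have hZ : ap = -1 := by exact_mod_cast this
      rw [hZ, Int.cast_neg, Int.cast_one]
    rw [hap1] at hn hne ⊢
    obtain ⟨hXt, g, hchar, ⟨u, hι⟩, -, -, -⟩ :=
      charIdeal_eq_span_of_wuthrichHalf_of_norm_coeff_of_budget hW16 hp2 hbud V C hC hirrV hκ hγ hγ' hf D _
        (Or.inr (Or.inr ⟨hV, hs, rfl⟩)) ϖ hϖ hn
    obtain ⟨hS, -, ℓ, -, hℓ1, hid⟩ :=
      schneider_and_padicVal_identity_rankOne_of_charIdeal_eq_span_of_iota_eq hp2 hr1 hB hκ hγ hγ' D hXt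
        hchar hι hne
    refine ⟨hS, ?_⟩
    rw [hℓ1 hX.potMult.reductionNonAnomalous, padicValNat_one_right, Nat.cast_zero, add_zero,
      padicValNat_card_addPrimaryComponent] at hid
    exact hid

/-! ### §2 HEADLINE: `BSD(E,p) ⟺ ord_p q + ord_p Reg_p(E,Dh) = 1 + v₁` on the index-`n₀` X3♯(M) rows -/

/-- **HEADLINE (X3♯(M) ∧ `r_an = 1`, EVERY odd `p`, `p = 3` included; `E[p]` REDUCIBLE): on an
index-`n₀` row of Route G, `BSD(E,p) ⟺ ord_p q + ord_p Reg_p(E,Dh) = 1 + v₁`** for every (B)-datum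
`Dh`, where `L'(E,1) = q·Ω_E·Reg_∞(E)` and `v₁ = v_p([T¹](ϖ·B))` for the twist datum at hand — GIVEN
Wuthrich's divisibility, the census record at `n₀`, the budget `BudgetLeLambdaAt p W n₀` and the bit
`[T¹](ϖ·B) ≠ 0`. `Ш` has disappeared: the residue of `BSD(E,p)` on these rows is ONE `p`-adic
valuation (the typed `p`-adic Gross–Zagier at the additive prime as an integer per pair). T-O7KM-X3's
headline `ClassX3M.bsdp_iff_padicVal_rankOne_of_wuthrichHalf_of_multCert` is the case `n₀ = 1`,
`v₁ = 0`. NO image hypothesis. Nothing booked; O7-ord OPEN. [cite: Wuthrich2014, Thm. 16 (p. 397)]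
[cite: Delbourgo2002, Theorem (B) (p. 40)] [cite: Miller2011LMS, Def. 1.1]
[cite: EmertonPollackWeston2006, Cor. 3.2.5 and Thm. 3.1.1 (typed input's source on IRREDUCIBLE rows only; X3: see header)] -/
theorem ClassX3M.bsdp_iff_padicVal_rankOne_of_wuthrichHalf_of_firstUnitIndex_of_budget
    (hW16 : Wuthrich2014.thm16_halfEigenCharIdeal_dvd_cyclotomicPrime)
    (hGZK : rank_eq_analyticRank_of_analyticRank_le_one) (hmod : hasEntireLFunction_rat)
    (hX : ClassX3M W p) (hr : W.analyticRank = 1) {n₀ : ℕ}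
    (hrec : (p % 4 = 1 → MultFirstUnitIndexAt W p n₀) ∧ (p % 4 = 3 → MultOddFirstUnitIndexAt W p n₀))
    (hbud : BudgetLeLambdaAt p W n₀)
    (V : WeierstrassCurve ℚ) [V.IsElliptic] [V.IsGloballyMinimal] (C : VariableChange ℚ)
    (hV : Mult V p) (hC : C • V.quadraticTwist ((-1 : ℚ) ^ (p / 2) * p) = W)
    {N : ℕ} [NeZero N] {f : CuspForm (Gamma0 N) 2} (hf : IsNewformOf V f) (ap : ℤ)
    (hap : cuspCoeff f p = ap) (ϖ : ℚ)
    (hϖ : if Even (p / 2) then (ϖ : ℝ) * V.realPeriodRat = plusPeriod f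
      else (ϖ : ℝ) * V.imaginaryPeriodRat = minusPeriod f)
    (hne : PowerSeries.coeff 1 (PowerSeries.C (ϖ : ℚ_[p]) *
      (if Even (p / 2) then padicLFunctionPlusBranchMult f (ap : ℚ_[p]) (p / 2)
        else padicLFunctionMinusBranchMult f (ap : ℚ_[p]) (p / 2))) ≠ 0)
    {Dh : PAdicHeightData W p} (hB : LeadingTermClauses W p Dh)
    {q : ℚ} (hLq : W.leadingLCoeff = (q : ℂ) * (W.realPeriodRat : ℂ) * (W.regulator : ℂ)) :
    BSDp W p ↔
      padicValRat p q + (padicRegulator Dh).valuation =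
        1 + (PowerSeries.coeff 1 (PowerSeries.C (ϖ : ℚ_[p]) *
            (if Even (p / 2) then padicLFunctionPlusBranchMult f (ap : ℚ_[p]) (p / 2)
              else padicLFunctionMinusBranchMult f (ap : ℚ_[p]) (p / 2)))).valuation := by
  obtain ⟨-, hid⟩ := hX.schneider_and_padicVal_identity_rankOne_of_wuthrichHalf_of_firstUnitIndex_of_budget
    hW16 hGZK hr hrec hbud V C hV hC hf ap hap ϖ hϖ hne hB
  have hq0 : q ≠ 0 := by
    rintro rfl
    rw [Rat.cast_zero, zero_mul, zero_mul] at hLq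
    exact W.leadingLCoeff_ne_zero_holds (hmod W) hLq
  set v₁ := (PowerSeries.coeff 1 (PowerSeries.C (ϖ : ℚ_[p]) *
      (if Even (p / 2) then padicLFunctionPlusBranchMult f (ap : ℚ_[p]) (p / 2)
        else padicLFunctionMinusBranchMult f (ap : ℚ_[p]) (p / 2)))).valuation
  have hid' : (padicValNat p W.shaOrder : ℤ) + ((padicRegulator Dh).valuation - v₁) +
      padicValNat p W.tamagawaProduct = 1 + 2 * padicValNat p W.torsionOrder := by
    linarith
  have h := bsdp_iff_padicValRat_add_eq_one (W := W) (p := p) hGZK (by rw [hr]) hq0 hLq hid'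
  rw [h]
  constructor <;> intro h' <;> linarith

end Identity

/-! ### §3 CENSUS-LITERAL forms: the valuation column `CensusQ6.MultCoeffValAt W p 1 v₁` (`v₁ ∈ ℤ`) -/

section Column

variable {W : WeierstrassCurve ℚ} [W.IsElliptic] [W.IsGloballyMinimal] {p : ℕ} [hp : Fact p.Prime]

/-- **The `v₁`-identity with the census COLUMN, X3♯(M) ∧ `r_an = 1`, EVERY odd `p` (`p = 3` included):**
Wuthrich's half `hW16` + the Q6 record at index `n₀` + the budget `BudgetLeLambdaAt p W n₀` +
census-ctyper1's valuation record `CensusQ6.MultCoeffValAt W p 1 v₁` (`‖[T¹](ϖ·B)‖_p = p^{−v₁}` on EVERY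
multiplicative twist datum — it carries the one-sided bit `c₁ ≠ 0` AND the value,
`MultCoeffValAt.coeff_ne_zero_and_valuation_eq`) ⟹ for every (B)-datum `Dh`: Schneider and
**`ord_p #Ш(E) + ord_p Reg_p(E,Dh) + ord_p ∏c_ℓ = v₁ + 1 + 2·ord_p #E(ℚ)_tors`** with the INTEGER `v₁` of
the record — NO twist datum in the statement (one is produced inside: the multiplicative `p*`-twist
model `ClassX3M.exists_mult_pStar_twist_model`, its modular parametrisation `hmodD`, a period ratio of
the right parity `exists_periodRatio_parity`, `a_p = ±1`). §1 BY NAME.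
[cite: Wuthrich2014, Thm. 16 (p. 397)] [cite: Delbourgo2002, Theorem (B) (p. 40), ℓ_p(E) = 1 (p. 39)]
[cite: MazurTateTeitelbaum1986Invent, §I.10, §I.13 (the branch series; the column is EVIDENCE, nothing asserted)] -/
theorem ClassX3M.schneider_and_padicVal_identity_rankOne_of_wuthrichHalf_of_firstUnitIndex_of_multCoeffValAt_of_budget
    (hW16 : Wuthrich2014.thm16_halfEigenCharIdeal_dvd_cyclotomicPrime)
    (hmodD : nonempty_modularParametrizationData)
    (hGZK : rank_eq_analyticRank_of_analyticRank_le_one)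
    (hX : ClassX3M W p) (hr : W.analyticRank = 1) {n₀ : ℕ}
    (hrec : (p % 4 = 1 → MultFirstUnitIndexAt W p n₀) ∧ (p % 4 = 3 → MultOddFirstUnitIndexAt W p n₀))
    (hbud : BudgetLeLambdaAt p W n₀) {v₁ : ℤ} (hv : MultCoeffValAt W p 1 v₁)
    {Dh : PAdicHeightData W p} (hB : LeadingTermClauses W p Dh) :
    SchneiderConjecture Dh ∧
      (padicValNat p W.shaOrder : ℤ) + (padicRegulator Dh).valuation + padicValNat p W.tamagawaProduct =
        v₁ + 1 + 2 * padicValNat p W.torsionOrder := by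
  obtain ⟨V, iV, iVm, C, hV, hC⟩ := hX.exists_mult_pStar_twist_model
  haveI : NeZero (V.conductorNorm ℤ) := ⟨(V.conductorNorm_pos_holds).ne'⟩
  obtain ⟨Dm⟩ := hmodD V
  obtain ⟨ϖ, hϖ⟩ := exists_periodRatio_parity (p := p) V Dm
  -- an integer `a_p` for the newform: `a_p = 1` (split) or `a_p = −1` (non-split)
  obtain ⟨ap, hap⟩ : ∃ ap : ℤ, cuspCoeff Dm.f p = ap := by
    by_cases hs : V.HasSplitMultiplicativeReductionAtPrime p
    · exact ⟨1, by exact_mod_cast (Dm.isNewformOf.cuspCoeff_eq_one_and_sq_of_split hs).1⟩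
    · exact ⟨-1, by exact_mod_cast (Dm.isNewformOf.cuspCoeff_eq_neg_one_and_dvd_of_nonsplit hV hs).1⟩
  obtain ⟨hne, hval⟩ := hv.coeff_ne_zero_and_valuation_eq V C hV hC Dm.f Dm.isNewformOf ap hap ϖ hϖ
  obtain ⟨hS, hid⟩ :=
    hX.schneider_and_padicVal_identity_rankOne_of_wuthrichHalf_of_firstUnitIndex_of_budget hW16 hGZK hr
      hrec hbud V C hV hC Dm.isNewformOf ap hap ϖ hϖ hne hB
  rw [hval] at hid
  exact ⟨hS, hid⟩

/-- **HEADLINE with the census COLUMN (X3♯(M) ∧ `r_an = 1`, EVERY odd `p`, `p = 3` included):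
`BSD(E,p) ⟺ ord_p q + ord_p Reg_p(E,Dh) = 1 + v₁`** for every (B)-datum `Dh`, where
`L'(E,1) = q·Ω_E·Reg_∞(E)` and `v₁ ∈ ℤ` is census-ctyper1's column `CensusQ6.MultCoeffValAt W p 1 v₁` —
GIVEN Wuthrich's divisibility, the Q6 record at `n₀` and the budget `BudgetLeLambdaAt p W n₀`. The
residue of `BSD(E,p)` on these rows is ONE `p`-adic valuation `v(Reg_p)` against two census integers
(`ord_p q`, `v₁`); `v(Reg_p)` has no engine in the cell. NO image hypothesis; nothing booked; O7-ord
OPEN. [cite: Wuthrich2014, Thm. 16 (p. 397)] [cite: Delbourgo2002, Theorem (B) (p. 40)]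
[cite: Miller2011LMS, Def. 1.1] [cite: MazurTateTeitelbaum1986Invent, §I.10, §I.13 (the column is EVIDENCE)] -/
theorem ClassX3M.bsdp_iff_padicVal_rankOne_of_wuthrichHalf_of_firstUnitIndex_of_multCoeffValAt_of_budget
    (hW16 : Wuthrich2014.thm16_halfEigenCharIdeal_dvd_cyclotomicPrime)
    (hmodD : nonempty_modularParametrizationData)
    (hGZK : rank_eq_analyticRank_of_analyticRank_le_one) (hmod : hasEntireLFunction_rat)
    (hX : ClassX3M W p) (hr : W.analyticRank = 1) {n₀ : ℕ}
    (hrec : (p % 4 = 1 → MultFirstUnitIndexAt W p n₀) ∧ (p % 4 = 3 → MultOddFirstUnitIndexAt W p n₀))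
    (hbud : BudgetLeLambdaAt p W n₀) {v₁ : ℤ} (hv : MultCoeffValAt W p 1 v₁)
    {Dh : PAdicHeightData W p} (hB : LeadingTermClauses W p Dh)
    {q : ℚ} (hLq : W.leadingLCoeff = (q : ℂ) * (W.realPeriodRat : ℂ) * (W.regulator : ℂ)) :
    BSDp W p ↔ padicValRat p q + (padicRegulator Dh).valuation = 1 + v₁ := by
  obtain ⟨-, hid⟩ :=
    hX.schneider_and_padicVal_identity_rankOne_of_wuthrichHalf_of_firstUnitIndex_of_multCoeffValAt_of_budget
      hW16 hmodD hGZK hr hrec hbud hv hB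
  have hq0 : q ≠ 0 := by
    rintro rfl
    rw [Rat.cast_zero, zero_mul, zero_mul] at hLq
    exact W.leadingLCoeff_ne_zero_holds (hmod W) hLq
  have hid' : (padicValNat p W.shaOrder : ℤ) + ((padicRegulator Dh).valuation - v₁) +
      padicValNat p W.tamagawaProduct = 1 + 2 * padicValNat p W.torsionOrder := by
    linarith
  have h := bsdp_iff_padicValRat_add_eq_one (W := W) (p := p) hGZK (by rw [hr]) hq0 hLq hid'
  rw [h]
  constructor <;> intro h' <;> linarith

/-- **`p = 3` form of the column identity** (the X3♯(M) `r_an = 1` rows at `3`, the (M)@3 share of N11 /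
O7): record `MultOddFirstUnitIndexAt W 3 n₀` (odd branch: twist `−3`, `Ω⁻`, `L_3^−`) + budget
`BudgetLeLambdaAt 3 W n₀` + column `MultCoeffValAt W 3 1 v₁` ⟹ for every (B)-datum at `3`: Schneider and
`ord_3 #Ш(E) + ord_3 Reg_3(E,Dh) + ord_3 ∏c_ℓ = v₁ + 1 + 2·ord_3 #E(ℚ)_tors`.
[cite: Wuthrich2014, Thm. 16 (p. 397)] [cite: Delbourgo2002, Theorem (B) (p. 40)] -/
theorem ClassX3M.schneider_and_padicVal_identity_three_rankOne_of_wuthrichHalf_of_firstUnitIndex_of_multCoeffValAt_of_budget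
    [Fact (Nat.Prime 3)] {W : WeierstrassCurve ℚ} [W.IsElliptic] [W.IsGloballyMinimal]
    (hW16 : Wuthrich2014.thm16_halfEigenCharIdeal_dvd_cyclotomicPrime)
    (hmodD : nonempty_modularParametrizationData)
    (hGZK : rank_eq_analyticRank_of_analyticRank_le_one)
    (hX : ClassX3M W 3) (hr : W.analyticRank = 1) {n₀ : ℕ}
    (hrec : MultOddFirstUnitIndexAt W 3 n₀) (hbud : BudgetLeLambdaAt 3 W n₀) {v₁ : ℤ}
    (hv : MultCoeffValAt W 3 1 v₁) {Dh : PAdicHeightData W 3} (hB : LeadingTermClauses W 3 Dh) :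
    SchneiderConjecture Dh ∧
      (padicValNat 3 W.shaOrder : ℤ) + (padicRegulator Dh).valuation + padicValNat 3 W.tamagawaProduct =
        v₁ + 1 + 2 * padicValNat 3 W.torsionOrder :=
  hX.schneider_and_padicVal_identity_rankOne_of_wuthrichHalf_of_firstUnitIndex_of_multCoeffValAt_of_budget
    hW16 hmodD hGZK hr ⟨fun h ↦ absurd h (by norm_num), fun _ ↦ hrec⟩ hbud hv hB

/-- **`p = 3` HEADLINE with the column**: on an X3♯(M) `r_an = 1` row at `3` with record
`MultOddFirstUnitIndexAt W 3 n₀`, budget `BudgetLeLambdaAt 3 W n₀` and column `MultCoeffValAt W 3 1 v₁`,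
**`BSD(E,3) ⟺ ord_3 q + ord_3 Reg_3(E,Dh) = 1 + v₁`** for every (B)-datum at `3`
(`L'(E,1) = q·Ω_E·Reg_∞(E)`). Nothing booked; N11 / O7-ord OPEN. [cite: Wuthrich2014, Thm. 16 (p. 397)]
[cite: Delbourgo2002, Theorem (B) (p. 40)] [cite: Miller2011LMS, Def. 1.1] -/
theorem ClassX3M.bsdp_three_iff_padicVal_rankOne_of_wuthrichHalf_of_firstUnitIndex_of_multCoeffValAt_of_budget
    [Fact (Nat.Prime 3)] {W : WeierstrassCurve ℚ} [W.IsElliptic] [W.IsGloballyMinimal]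
    (hW16 : Wuthrich2014.thm16_halfEigenCharIdeal_dvd_cyclotomicPrime)
    (hmodD : nonempty_modularParametrizationData)
    (hGZK : rank_eq_analyticRank_of_analyticRank_le_one) (hmod : hasEntireLFunction_rat)
    (hX : ClassX3M W 3) (hr : W.analyticRank = 1) {n₀ : ℕ}
    (hrec : MultOddFirstUnitIndexAt W 3 n₀) (hbud : BudgetLeLambdaAt 3 W n₀) {v₁ : ℤ}
    (hv : MultCoeffValAt W 3 1 v₁) {Dh : PAdicHeightData W 3} (hB : LeadingTermClauses W 3 Dh)
    {q : ℚ} (hLq : W.leadingLCoeff = (q : ℂ) * (W.realPeriodRat : ℂ) * (W.regulator : ℂ)) :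
    BSDp W 3 ↔ padicValRat 3 q + (padicRegulator Dh).valuation = 1 + v₁ :=
  hX.bsdp_iff_padicVal_rankOne_of_wuthrichHalf_of_firstUnitIndex_of_multCoeffValAt_of_budget hW16 hmodD
    hGZK hmod hr ⟨fun h ↦ absurd h (by norm_num), fun _ ↦ hrec⟩ hbud hv hB hLq

/-- **Index `1` with the column: NO budget.** X3♯(M) ∧ `r_an = 1`, EVERY odd `p`: a Q6 record at index
`1` (`n₀ = 1 = rank E(ℚ)` by GZK, so the budget is p07's theorem `budgetLeLambdaAt_of_le_mordellWeilRank`)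
+ the column `MultCoeffValAt W p 1 v₁` ⟹ `BSD(E,p) ⟺ ord_p q + ord_p Reg_p(E,Dh) = 1 + v₁`. (On such
rows the record's unit at index `1` forces `v₁ = 0` — T-O7KM-X3's headline; stated here in the column's
currency so census consumers need not case on `n₀`.) [cite: Wuthrich2014, Thm. 16 (p. 397)]
[cite: Delbourgo2002, Theorem (B) (p. 40)] [cite: GreenbergLNM1716, §3 Lemma 3.1 (T^{rank} ∣ char)] -/
theorem ClassX3M.bsdp_iff_padicVal_rankOne_of_wuthrichHalf_of_firstUnitIndex_one_of_multCoeffValAt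
    (hW16 : Wuthrich2014.thm16_halfEigenCharIdeal_dvd_cyclotomicPrime)
    (hmodD : nonempty_modularParametrizationData)
    (hGZK : rank_eq_analyticRank_of_analyticRank_le_one) (hmod : hasEntireLFunction_rat)
    (hX : ClassX3M W p) (hr : W.analyticRank = 1)
    (hrec : (p % 4 = 1 → MultFirstUnitIndexAt W p 1) ∧ (p % 4 = 3 → MultOddFirstUnitIndexAt W p 1))
    {v₁ : ℤ} (hv : MultCoeffValAt W p 1 v₁)
    {Dh : PAdicHeightData W p} (hB : LeadingTermClauses W p Dh)
    {q : ℚ} (hLq : W.leadingLCoeff = (q : ℂ) * (W.realPeriodRat : ℂ) * (W.regulator : ℂ)) :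
    BSDp W p ↔ padicValRat p q + (padicRegulator Dh).valuation = 1 + v₁ :=
  hX.bsdp_iff_padicVal_rankOne_of_wuthrichHalf_of_firstUnitIndex_of_multCoeffValAt_of_budget hW16 hmodD
    hGZK hmod hr hrec (budgetLeLambdaAt_of_le_mordellWeilRank (by rw [(hGZK W (by rw [hr])).1, hr])) hv hB
    hLq

end Column

end Summit.BirchSwinnertonDyer.Rank1Residual.AdditivePotMult

end
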